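import Summits.KontsevichZagierPeriods.KontsevichZagierPeriods.Theorems.GenusTwoCycleTransfer.Negative.Witnesses

/-!
# `RealEllipticSectorKernel` (stmt-KontsevichZagierPeriods-10632), line `oval-hermite-engine`: the endpoint hypotheses of the oval exact-form stub are load-bearing

Negative-side support (drefute unit, stub set of the lead's skeleton `be982d63baee`; commentary in
`Cruxes/RealEllipticSectorKernel/DrefuteOvalHermiteEngine.md`). The hardest stub of the line,
`stub_exactForm`, says: for `g Q ∈ ℚ[X]`, `u < v` with `g(u) = g(v) = 0` and `g > 0` on `(u,v)`, every
representation `[(u,v), (Q′g + Qg′/2)/√g]` is a relation (one rule-3 move, primitive `Q√g`). Its whole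
content is the vanishing of the boundary term `Q(v)√g(v) − Q(u)√g(u)`; we certify this by refuting the
two one-sided variants:

* `not_ovalExactFormWithoutRightEndpoint`: with `hv : g(v) = 0` deleted the statement is FALSE —
  witness `g = 1 − X²`, `Q = 1`, `(u,v) = (−1,0)`: `g(−1) = 0`, `g > 0` on `(−1,0)`, the integrand is
  `−x/√(1−x²)`, and `[(−1,0), −x/√(1−x²)]` is an honest `KZ.IntegralRep 1` (`rightRep`) of value
  `[√(1−x²)]₋₁⁰ = 1 ≠ 0` (`value_rightRep`), hence not a relation (soundness `relations ≤ ker eval`).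
* `not_ovalExactFormWithoutLeftEndpoint`: symmetrically, with `hu : g(u) = 0` deleted — witness
  `g = 1 − X²`, `Q = 1`, `(u,v) = (0,1)`, value `−1`.

(The other two hypotheses are NOT load-bearing salva veritate — `u < v` (empty domain) and, because of
the junk value `x/√y = 0` for `y ≤ 0`, even `g > 0` on `(u,v)`; see the drefute note.) The honest
representations are built exactly as the provers must build the line's normal forms: polynomial ×
`√`(rational function) is semialgebraic (`isSemialgebraicFunOn_aeval`, `isSemialgebraicFunOn_aeval_div_aeval`,
`IsSemialgebraicFunOn.sqrt_holds`, `mul_holds`), the value by the fundamental theorem of calculus with a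
monotone primitive (`intervalIntegral.integrableOn_deriv_of_nonneg`), integrability on `ℝ¹` read off
from the non-zero value (transfer `ℝ¹ ↔ ℝ` by `GenusTwoCycleTransferNegative.setIntegral_fin_one`).

Sources: M. Kontsevich, D. Zagier, *Periods* (2001), §§1.1–1.2 (the move and its boundary term);
J. Bochnak, M. Coste, M.-F. Roy, *Real Algebraic Geometry* (1998), §2.2. -/

noncomputable section

namespace Summit.KontsevichZagierPeriods.RealEllipticSectorKernel.ExactFormEndpoints

open MeasureTheory Set Polynomial
open Literature.NumberTheory.Transcendental Literature.ModelTheory.ExponentialFields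
open Summit.KontsevichZagierPeriods.HermiteRigidity.GenusTwoCycleTransferNegative (setIntegral_fin_one)

/-! ### The witness integrand `−x/√(1−x²)` = `d/dx √(1−x²)` -/

/-- The witness integrand on `ℝ¹`: `p ↦ −p₀/√(1 − p₀²)`. [folklore] -/
def integrand (p : Fin 1 → ℝ) : ℝ := -p 0 / Real.sqrt (1 - p 0 ^ 2)

/-- The right witness domain `(−1, 0) ⊆ ℝ¹`. [folklore] -/
def domR : Set (Fin 1 → ℝ) := {p | -1 < p 0 ∧ p 0 < 0}

/-- The left witness domain `(0, 1) ⊆ ℝ¹`. [folklore] -/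
def domL : Set (Fin 1 → ℝ) := {p | 0 < p 0 ∧ p 0 < 1}

/-- `(−1,0) ⊆ ℝ¹` is `ℚ`-semialgebraic. [cite: BochnakCosteRoy1998, Def. 2.1.4] -/
theorem isSemialgebraic_domR : IsSemialgebraic ℚ domR := by
  convert (isSemialgebraic_setOf_eval_pos (k := ℚ) (R := ℝ)
      (MvPolynomial.X 0 + 1 : MvPolynomial (Fin 1) ℚ)).inter
    (isSemialgebraic_setOf_eval_pos (k := ℚ) (R := ℝ) (-MvPolynomial.X 0 : MvPolynomial (Fin 1) ℚ))
    using 1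
  ext p
  simp only [domR, mem_setOf_eq, mem_inter_iff, map_add, map_one, map_neg, MvPolynomial.aeval_X]
  constructor
  · rintro ⟨h1, h2⟩; exact ⟨by linarith, by linarith⟩
  · rintro ⟨h1, h2⟩; exact ⟨by linarith, by linarith⟩

/-- `(0,1) ⊆ ℝ¹` is `ℚ`-semialgebraic. [cite: BochnakCosteRoy1998, Def. 2.1.4] -/
theorem isSemialgebraic_domL : IsSemialgebraic ℚ domL := by
  convert (isSemialgebraic_setOf_eval_pos (k := ℚ) (R := ℝ)
      (MvPolynomial.X 0 : MvPolynomial (Fin 1) ℚ)).inter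
    (isSemialgebraic_setOf_eval_pos (k := ℚ) (R := ℝ) (1 - MvPolynomial.X 0 : MvPolynomial (Fin 1) ℚ))
    using 1
  ext p
  simp only [domL, mem_setOf_eq, mem_inter_iff, map_sub, map_one, MvPolynomial.aeval_X, sub_pos]

/-- On a `ℚ`-semialgebraic set where `p₀² ≠ 1`, the witness integrand is `ℚ`-semialgebraic
(polynomial times `√` of a rational function). [cite: BochnakCosteRoy1998, §2.2] -/
theorem integrand_semialgebraic {s : Set (Fin 1 → ℝ)} (hs : IsSemialgebraic ℚ s)
    (hne : ∀ p ∈ s, 1 - p 0 ^ 2 ≠ 0) : IsSemialgebraicFunOn ℚ s integrand := by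
  have h1 : IsSemialgebraicFunOn ℚ s (fun p => MvPolynomial.aeval p (-MvPolynomial.X 0 : MvPolynomial (Fin 1) ℚ)) :=
    isSemialgebraicFunOn_aeval hs _
  have hne' : ∀ p ∈ s, MvPolynomial.aeval p (1 - MvPolynomial.X 0 ^ 2 : MvPolynomial (Fin 1) ℚ) ≠ 0 := by
    intro p hp
    simpa using hne p hp
  have h2 := isSemialgebraicFunOn_aeval_div_aeval hs (1 : MvPolynomial (Fin 1) ℚ)
    (1 - MvPolynomial.X 0 ^ 2) hne'
  have h3 := IsSemialgebraicFunOn.sqrt_holds h2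
  have h4 := IsSemialgebraicFunOn.mul_holds h1 h3
  refine h4.congr (fun p _ => ?_)
  simp only [Pi.mul_apply, map_neg, MvPolynomial.aeval_X, map_one, map_sub, map_pow, integrand,
    div_eq_mul_inv, one_mul, Real.sqrt_inv]

/-! ### Values by the fundamental theorem of calculus -/

/-- `d/dx √(1 − x²) = −x/√(1 − x²)` where `x² ≠ 1`. [folklore] -/
theorem hasDerivAt_sqrt_one_sub_sq {x : ℝ} (hx : 1 - x ^ 2 ≠ 0) :
    HasDerivAt (fun y : ℝ => Real.sqrt (1 - y ^ 2)) (-x / Real.sqrt (1 - x ^ 2)) x := by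
  have h1 : HasDerivAt (fun y : ℝ => 1 - y ^ 2) (-(2 * x)) x := by
    simpa using ((hasDerivAt_pow 2 x).const_sub 1)
  convert h1.sqrt hx using 1
  field_simp

/-- `∫₋₁⁰ −x/√(1−x²) dx = 1`. [folklore] -/
theorem integral_right : ∫ x in (-1 : ℝ)..0, -x / Real.sqrt (1 - x ^ 2) = 1 := by
  have hcont : ContinuousOn (fun y : ℝ => Real.sqrt (1 - y ^ 2)) (Icc (-1) 0) :=
    (Real.continuous_sqrt.comp (by fun_prop)).continuousOn
  have hderiv : ∀ x ∈ Ioo (-1 : ℝ) 0,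
      HasDerivAt (fun y : ℝ => Real.sqrt (1 - y ^ 2)) (-x / Real.sqrt (1 - x ^ 2)) x := fun x hx =>
    hasDerivAt_sqrt_one_sub_sq (by nlinarith [hx.1, hx.2])
  have hint : IntervalIntegrable (fun x : ℝ => -x / Real.sqrt (1 - x ^ 2)) volume (-1) 0 := by
    have h := intervalIntegral.integrableOn_deriv_of_nonneg hcont hderiv (fun x hx => by
      have : 0 ≤ -x := by linarith [hx.2]
      positivity)
    exact (intervalIntegrable_iff_integrableOn_Ioc_of_le (by norm_num)).mpr h
  rw [intervalIntegral.integral_eq_sub_of_hasDerivAt_of_le (by norm_num) hcont hderiv hint]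
  norm_num

/-- `∫₀¹ −x/√(1−x²) dx = −1`. [folklore] -/
theorem integral_left : ∫ x in (0 : ℝ)..1, -x / Real.sqrt (1 - x ^ 2) = -1 := by
  have hcont : ContinuousOn (fun y : ℝ => -Real.sqrt (1 - y ^ 2)) (Icc 0 1) :=
    (Real.continuous_sqrt.comp (by fun_prop)).neg.continuousOn
  have hderiv : ∀ x ∈ Ioo (0 : ℝ) 1,
      HasDerivAt (fun y : ℝ => -Real.sqrt (1 - y ^ 2)) (x / Real.sqrt (1 - x ^ 2)) x := by
    intro x hx
    have h := (hasDerivAt_sqrt_one_sub_sq (x := x) (by nlinarith [hx.1, hx.2])).neg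
    have e : -(-x / Real.sqrt (1 - x ^ 2)) = x / Real.sqrt (1 - x ^ 2) := by ring
    rw [e] at h
    exact h
  have hint : IntervalIntegrable (fun x : ℝ => x / Real.sqrt (1 - x ^ 2)) volume 0 1 := by
    have h := intervalIntegral.integrableOn_deriv_of_nonneg hcont hderiv (fun x hx => by
      have : 0 ≤ x := hx.1.le
      positivity)
    exact (intervalIntegrable_iff_integrableOn_Ioc_of_le (by norm_num)).mpr h
  have key := intervalIntegral.integral_eq_sub_of_hasDerivAt_of_le (by norm_num) hcont hderiv hint
  have e : (fun x : ℝ => -x / Real.sqrt (1 - x ^ 2)) = fun x => -(x / Real.sqrt (1 - x ^ 2)) := by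
    funext x; ring
  rw [e, intervalIntegral.integral_neg, key]
  norm_num

/-- Value of the right witness: `∫_{(−1,0)} −x/√(1−x²) = 1`. [folklore] -/
theorem setIntegral_domR : ∫ p in domR, integrand p = 1 := by
  have h := setIntegral_fin_one (fun x => -x / Real.sqrt (1 - x ^ 2)) (Ioo (-1) 0)
  have hd : domR = {p : Fin 1 → ℝ | p 0 ∈ Ioo (-1 : ℝ) 0} := by ext p; simp [domR]
  rw [hd]
  rw [show (fun p : Fin 1 → ℝ => integrand p) = fun p => (fun x => -x / Real.sqrt (1 - x ^ 2)) (p 0)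
    from rfl, h, ← integral_Ioc_eq_integral_Ioo, ← intervalIntegral.integral_of_le (by norm_num),
    integral_right]

/-- Value of the left witness: `∫_{(0,1)} −x/√(1−x²) = −1`. [folklore] -/
theorem setIntegral_domL : ∫ p in domL, integrand p = -1 := by
  have h := setIntegral_fin_one (fun x => -x / Real.sqrt (1 - x ^ 2)) (Ioo 0 1)
  have hd : domL = {p : Fin 1 → ℝ | p 0 ∈ Ioo (0 : ℝ) 1} := by ext p; simp [domL]
  rw [hd]
  rw [show (fun p : Fin 1 → ℝ => integrand p) = fun p => (fun x => -x / Real.sqrt (1 - x ^ 2)) (p 0)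
    from rfl, h, ← integral_Ioc_eq_integral_Ioo, ← intervalIntegral.integral_of_le (by norm_num),
    integral_left]

/-- Integrability of the right witness, read off from the non-zero value. [folklore] -/
theorem integrableOn_domR : IntegrableOn integrand domR := by
  by_contra h
  have h0 := integral_undef h
  have h1 := setIntegral_domR
  rw [h0] at h1
  norm_num at h1

/-- Integrability of the left witness, read off from the non-zero value. [folklore] -/
theorem integrableOn_domL : IntegrableOn integrand domL := by
  by_contra h
  have h0 := integral_undef h
  have h1 := setIntegral_domL
  rw [h0] at h1
  norm_num at h1

/-! ### The honest representations and the refutations -/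

/-- **The right witness** `[(−1,0), −x/√(1−x²)]` as an honest `KZ.IntegralRep 1`.
[cite: KontsevichZagier2001, §1.1] -/
def rightRep : KZ.IntegralRep 1 where
  domain := domR
  integrand := integrand
  isSemialgebraic_domain := isSemialgebraic_domR
  isSemialgebraicFunOn_integrand :=
    integrand_semialgebraic isSemialgebraic_domR (fun p hp => by
      have := hp.1; have := hp.2; nlinarith)
  integrableOn := integrableOn_domR

/-- **The left witness** `[(0,1), −x/√(1−x²)]` as an honest `KZ.IntegralRep 1`.
[cite: KontsevichZagier2001, §1.1] -/
def leftRep : KZ.IntegralRep 1 where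
  domain := domL
  integrand := integrand
  isSemialgebraic_domain := isSemialgebraic_domL
  isSemialgebraicFunOn_integrand :=
    integrand_semialgebraic isSemialgebraic_domL (fun p hp => by
      have := hp.1; have := hp.2; nlinarith)
  integrableOn := integrableOn_domL

/-- The right witness has value `1`. [folklore] -/
theorem value_rightRep : rightRep.value = 1 := setIntegral_domR

/-- The left witness has value `−1`. [folklore] -/
theorem value_leftRep : leftRep.value = -1 := setIntegral_domL

/-- The right witness is not a relation (soundness of the calculus). [cite: KontsevichZagier2001, §1.2] -/
theorem of_rightRep_not_mem_relations : KZ.of rightRep ∉ KZ.relations := fun h => by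
  have h0 := KZ.relations_le_ker_eval_holds h
  rw [AddMonoidHom.mem_ker, KZ.eval_of, value_rightRep] at h0
  norm_num at h0

/-- The left witness is not a relation (soundness of the calculus). [cite: KontsevichZagier2001, §1.2] -/
theorem of_leftRep_not_mem_relations : KZ.of leftRep ∉ KZ.relations := fun h => by
  have h0 := KZ.relations_le_ker_eval_holds h
  rw [AddMonoidHom.mem_ker, KZ.eval_of, value_leftRep] at h0
  norm_num at h0

/-- The stub's integrand formula at `g = 1 − X²`, `Q = 1` is the witness integrand `−x/√(1−x²)`.
[folklore] -/
theorem formula_eq_integrand (p : Fin 1 → ℝ) :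
    (aeval (p 0) (derivative (1 : ℚ[X])) * aeval (p 0) (1 - X ^ 2 : ℚ[X])
      + aeval (p 0) (1 : ℚ[X]) * aeval (p 0) (derivative (1 - X ^ 2 : ℚ[X])) / 2)
      / Real.sqrt (aeval (p 0) (1 - X ^ 2 : ℚ[X])) = integrand p := by
  simp only [derivative_one, map_zero, zero_mul, zero_add, map_one, one_mul,
    derivative_X_pow, map_sub, map_mul, integrand]
  norm_num
  ring

/-- **`hv : g(v) = 0` is load-bearing in `stub_exactForm`**: the stub of line `oval-hermite-engine`
(skeleton `be982d63baee`, verbatim) with the right-endpoint hypothesis `hv : aeval v g = 0` DELETED is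
FALSE (witness `g = 1 − X²`, `Q = 1`, `(u,v) = (−1,0)`, value `1`). Any proof of the stub must use
`hv` — the boundary term `Q(v)√g(v)` is the whole content of the move. [cite: KontsevichZagier2001, §1.2 rule (3)] -/
theorem not_ovalExactFormWithoutRightEndpoint : ¬ (
    ∀ (g Q : ℚ[X]) (u v : ℝ) (_huv : u < v) (_hu : aeval u g = 0)
      (_hpos : ∀ x ∈ Ioo u v, 0 < aeval x g) (r : KZ.IntegralRep 1)
      (_hr : r.domain = {p | u < p 0 ∧ p 0 < v})
      (_hri : EqOn r.integrand (fun p => (aeval (p 0) (derivative Q) * aeval (p 0) g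
        + aeval (p 0) Q * aeval (p 0) (derivative g) / 2) / Real.sqrt (aeval (p 0) g)) r.domain),
      KZ.of r ∈ KZ.relations) := by
  intro h
  refine of_rightRep_not_mem_relations
    (h (1 - X ^ 2) 1 (-1) 0 (by norm_num) (by simp) (fun x hx => ?_) rightRep rfl (fun p _ => ?_))
  · simp only [map_sub, map_one, map_pow, aeval_X, sub_pos]
    nlinarith [hx.1, hx.2]
  · exact (formula_eq_integrand p).symm

/-- **`hu : g(u) = 0` is load-bearing in `stub_exactForm`**: the same stub with the left-endpoint
hypothesis `hu : aeval u g = 0` DELETED is FALSE (witness `g = 1 − X²`, `Q = 1`, `(u,v) = (0,1)`, value `−1`). [cite: KontsevichZagier2001, §1.2 rule (3)] -/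
theorem not_ovalExactFormWithoutLeftEndpoint : ¬ (
    ∀ (g Q : ℚ[X]) (u v : ℝ) (_huv : u < v) (_hv : aeval v g = 0)
      (_hpos : ∀ x ∈ Ioo u v, 0 < aeval x g) (r : KZ.IntegralRep 1)
      (_hr : r.domain = {p | u < p 0 ∧ p 0 < v})
      (_hri : EqOn r.integrand (fun p => (aeval (p 0) (derivative Q) * aeval (p 0) g
        + aeval (p 0) Q * aeval (p 0) (derivative g) / 2) / Real.sqrt (aeval (p 0) g)) r.domain),
      KZ.of r ∈ KZ.relations) := by
  intro h
  refine of_leftRep_not_mem_relations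
    (h (1 - X ^ 2) 1 0 1 (by norm_num) (by simp) (fun x hx => ?_) leftRep rfl (fun p _ => ?_))
  · simp only [map_sub, map_one, map_pow, aeval_X, sub_pos]
    nlinarith [hx.1, hx.2]
  · exact (formula_eq_integrand p).symm

end Summit.KontsevichZagierPeriods.RealEllipticSectorKernel.ExactFormEndpoints

end
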